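import Summits.AnomalousDissipation.AnomalousDissipation.Theses.DecimationAxis

/-!
# Route `DecimationAxis`, crux `GalerkinFloor` (stmt-AnomalousDissipation-1582):
# vocabulary and registered stub statements of the lines `birth` / `fraction`

`Defs` file (D-0016 `<Route>Defs` convention; precedent in this very route:
`DecimationAxisUniformEquilibrationDefs.lean`) of the crux skeleton
`Summits/AnomalousDissipation/AnomalousDissipation/Cruxes/GalerkinFloor/Lines/birth.lean`
(sha b3793ea2…, registrar planner-skel-stmt-AnomalousDissipation-1582-0; registered stubs
`stub_uniformGalerkinAnomaly`, `stub_fixedViscosityResolution`) and of the alternative line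
`Lines/fraction.lean` (registered stub `stub_uniformResolvedFraction`, same heart).  A
`Cruxes/…/Lines/*.lean` skeleton is not an importable module, so the vocabulary the line posits and
the STATEMENTS of its registered stubs live here — copied VERBATIM from the skeleton (same namespace
`Summit.AnomalousDissipation.AnomalousDissipation.Cruxes.GalerkinFloor.Birth`, same names;
only the local notations `ℤ³ := Fin 3 → ℤ`, `ℂ³ := EuclideanSpace ℂ (Fin 3)` are expanded) — to be imported by the stub / Tools
files `Theorems/DecimationAxisGalerkinFloor<…>.lean` (landed `--supports stmt-AnomalousDissipation-1582`)
and by the closing composition; the skeleton is re-pointed by importing this module and deleting its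
local copies (zero renaming).

Nothing open is asserted: every `def … : Prop` below is a statement (a registered stub signature, or
the fraction line's named fixed-viscosity target), consumed only as the type of a stub theorem or as
an explicit hypothesis; the theorems proved here are the two sorry-free compositions of the lines
(`GalerkinFloor_of` = birth §3, `GalerkinFloor_of_uniformResolvedFraction` = fraction §3; the crux
BY NAME) and the two by-statement comparisons of fraction §4 — pure bookkeeping, kernel-checked
already inside the line files.

Contents:
* §0 vocabulary naming the crux's own lambda terms (VERBATIM birth §0): `IsDesignerForce`,
  `IsCoeffTrajectory` (= the tree's `IsGalerkinODESolution ν (g↾S) (c 0) c` minus its `rfl` datum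
  clause; character-identical to `Cruxes.UniformEquilibration.Birth.IsCoeffTrajectory` of the sibling
  crux, kept separate so that each skeleton re-points to its own Defs file), `coeffEnergy`,
  `coeffDissipation`, `coeffResolvedDissipation`;
* §1 the registered signatures as Props: `Statement.stub_uniformGalerkinAnomaly`,
  `Statement.stub_fixedViscosityResolution` (birth), `Statement.stub_uniformResolvedFraction`
  (fraction), and fraction's named fixed-`ν` target `ResolvedFractionAtFixedViscosity`;
* §2 compositions `GalerkinFloor_of`, `GalerkinFloor_of_uniformResolvedFraction` and the comparisons
  `uniformResolvedFraction_of_fixedViscosityResolution`, `resolvedFractionAtFixedViscosity_of_uniform`.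

Deliberately NOT here: any proof of a stub, the sorried `stub_*` placeholders and
`GalerkinFloor_via_stubs` of the skeletons (they stay under `Cruxes/`).
Sources: FoiasManleyRosaTemam2001 Ch. IV–V; ConstantinFoias1988 Ch. 8; DoeringFoias2002 §2;
RobinsonRodrigoSadowski2016 Thm 4.4; KanedaEtAl2003.
-/

noncomputable section

-- D-0017: single-problem summit ⇒ the duplicated namespace segment is by design.
set_option linter.dupNamespace false

open Filter Set
open Literature.Analysis.FunctionSpaces.Torus Literature.Analysis.FluidPDE

namespace Summit.AnomalousDissipation.AnomalousDissipation.Cruxes.GalerkinFloor.Birth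

open Summit.AnomalousDissipation.AnomalousDissipation.Theses.DecimationAxis

/-! ## §0 Vocabulary — the sub-clauses of `GalerkinFloor`, VERBATIM, given names (transparent `def`s) -/

/-- **Designer force** (the four force clauses of `GalerkinFloor`, verbatim): a real (conjugate-symmetric)
coefficient family `g`, band-limited to `freqBall N`, without mean mode, transversal (`k · g k = 0`). -/
def IsDesignerForce (N : ℕ) (g : (Fin 3 → ℤ) → EuclideanSpace ℂ (Fin 3)) : Prop :=
  IsConjSymm g ∧ (∀ k, k ∉ freqBall N → g k = 0) ∧ g 0 = 0 ∧
    (∀ k : Fin 3 → ℤ, ∑ i, ((k i : ℤ) : ℂ) * g k i = 0)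

/-- **Galerkin trajectory on `S` at viscosity `ν` driven by `g↾S`** (the three solution clauses of
`GalerkinFloor`, verbatim — the solution notion of the tree's `exists_galerkin_solution`): values in the
Galerkin phase space, continuous on `[0, ∞)`, one-sided derivative `galerkinRHS` on every `[0, T]`. -/
def IsCoeffTrajectory (S : Finset (Fin 3 → ℤ)) (ν : ℝ) (g : (Fin 3 → ℤ) → EuclideanSpace ℂ (Fin 3)) (c : ℝ → ↥S → EuclideanSpace ℂ (Fin 3)) : Prop :=
  (∀ t, c t ∈ galerkinSubspace S) ∧ ContinuousOn c (Set.Ici 0) ∧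
    (∀ T : ℝ, ∀ t ∈ Set.Icc (0 : ℝ) T,
      HasDerivWithinAt c (galerkinRHS S ν (fun k => g k) (c t)) (Set.Icc 0 T) t)

/-- Kinetic energy `Σ_{k∈S} ‖c_k(t)‖²` (`= ∫|u|²` for `u = realTrigPoly S c̄`; verbatim the crux's functional). -/
def coeffEnergy {S : Finset (Fin 3 → ℤ)} (c : ℝ → ↥S → EuclideanSpace ℂ (Fin 3)) : ℝ → ℝ :=
  fun t => ∑ k : ↥S, ‖c t k‖ ^ 2

/-- TOTAL dissipation rate `ν‖∇u(t)‖² = ν·4π²·Σ_{k∈S} |k|²‖c_k(t)‖²` (all modes of `S`). -/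
def coeffDissipation {S : Finset (Fin 3 → ℤ)} (ν : ℝ) (c : ℝ → ↥S → EuclideanSpace ℂ (Fin 3)) : ℝ → ℝ :=
  fun t => ν * (4 * Real.pi ^ 2 * ∑ k : ↥S, freqNormSq (k : Fin 3 → ℤ) * ‖c t k‖ ^ 2)

/-- RESOLVED dissipation rate at wavenumber `M`: `ν·4π²·Σ_{k∈S, |k|≤M} |k|²‖c_k(t)‖²`
(verbatim the crux's functional). -/
def coeffResolvedDissipation {S : Finset (Fin 3 → ℤ)} (ν : ℝ) (M : ℕ) (c : ℝ → ↥S → EuclideanSpace ℂ (Fin 3)) : ℝ → ℝ :=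
  fun t => ν * (4 * Real.pi ^ 2 * ∑ k : ↥S,
    if freqNormSq (k : Fin 3 → ℤ) ≤ (M : ℝ) ^ 2 then freqNormSq (k : Fin 3 → ℤ) * ‖c t k‖ ^ 2 else 0)

/-! ## §1 The registered stub signatures, as Props (by statement, VERBATIM the registered signatures) -/

/-- Statement of registered stub 1 of both lines (`stub_uniformGalerkinAnomaly`, the HEART; XL, open):
some designer force `(N, g)`, budgets `E`, `ε > 0` and positive viscosities `ν_j → 0` such that for
every `j`, for all sufficiently large truncations `K`, SOME trajectory of the exact-coupling Galerkin
system on `S = freqBall K ∖ {0}` at viscosity `ν_j` has `limsup`-mean energy `≤ E` and `liminf`-mean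
TOTAL dissipation `≥ ε` (= `GalerkinFloor` with the resolution wavenumber removed).
Sources: KanedaEtAl2003, Sreenivasan1998, Frisch1995 §5.2, FoiasManleyRosaTemam2001 Ch. V,
DoeringFoias2002 §2; hub stmt-AnomalousDissipation-14283. -/
def Statement.stub_uniformGalerkinAnomaly : Prop :=
  ∃ (N : ℕ) (g : (Fin 3 → ℤ) → EuclideanSpace ℂ (Fin 3)), IsDesignerForce N g ∧ ∃ (E ε : ℝ), 0 < ε ∧ ∃ ν : ℕ → ℝ,
    (∀ j, 0 < ν j) ∧ Tendsto ν atTop (nhds 0) ∧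
    ∀ j, ∃ K₀ : ℕ, ∀ K, K₀ ≤ K → ∀ S : Finset (Fin 3 → ℤ), S = (freqBall K).erase 0 →
      ∃ c : ℝ → ↥S → EuclideanSpace ℂ (Fin 3), IsCoeffTrajectory S (ν j) g c ∧
        longTimeAvgSup (coeffEnergy c) ≤ E ∧ ε ≤ longTimeAvgInf (coeffDissipation (ν j) c)

/-- Statement of registered stub 2 of line `birth` (`stub_fixedViscosityResolution`; L–XL, open,
regularity-flavoured): for every `ν > 0`, designer force `(N, g)`, budgets `E`, `ε` and loss `δ > 0`
there is ONE wavenumber `M` such that for EVERY truncation `K` and EVERY Galerkin trajectory on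
`freqBall K ∖ {0}` at viscosity `ν` with `limsup`-mean energy `≤ E` and `liminf`-mean total dissipation
`≥ ε`, the `liminf`-mean dissipation RESOLVED below `M` is `≥ ε − δ` (⟺ mean energy EQUALITY for
Galerkin-limit stationary statistics at `(g, ν)`; ⟸ `MomentParity.ResolvedDissipation` stmt-14284).
Trivially true for `ε ≤ δ` and for `K ≤ M`; the content is `ε > δ`, `K → ∞`.
Sources: FoiasManleyRosaTemam2001 Ch. IV (1.31)–(1.33), (3.6); FoiasGuillopeTemam1981;
FoiasRosaTemam2019 §4; DuchonRobert2000; hub stmt-14284 / -14330. -/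
def Statement.stub_fixedViscosityResolution : Prop :=
  ∀ ν : ℝ, 0 < ν → ∀ (N : ℕ) (g : (Fin 3 → ℤ) → EuclideanSpace ℂ (Fin 3)), IsDesignerForce N g → ∀ (E ε δ : ℝ), 0 < δ →
    ∃ M : ℕ, ∀ (K : ℕ) (S : Finset (Fin 3 → ℤ)), S = (freqBall K).erase 0 →
      ∀ c : ℝ → ↥S → EuclideanSpace ℂ (Fin 3), IsCoeffTrajectory S ν g c →
        longTimeAvgSup (coeffEnergy c) ≤ E → ε ≤ longTimeAvgInf (coeffDissipation ν c) →
          ε - δ ≤ longTimeAvgInf (coeffResolvedDissipation ν M c)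

/-- Statement of registered stub 2 of line `fraction` (`stub_uniformResolvedFraction`; strictly weaker
than birth's stub 2, see `uniformResolvedFraction_of_fixedViscosityResolution`): for every designer
force `(N, g)` and budgets `E`, `ε > 0` there is ONE `η > 0` such that for EVERY `ν > 0` some
wavenumber `M = M(ν)` resolves at least `η` of the time-averaged dissipation of EVERY loud(`ε`)
bounded(`E`) Galerkin trajectory at viscosity `ν`, at EVERY truncation `K`.  Open content: the
`ν`-uniformity of `η` (its fixed-`ν` instance `ResolvedFractionAtFixedViscosity` is a soft theorem).
Sources: FoiasManleyRosaTemam2001 Ch. IV (1.31)–(1.33), Ch. V; KanedaEtAl2003; hub stmt-14284, -14330. -/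
def Statement.stub_uniformResolvedFraction : Prop :=
  ∀ (N : ℕ) (g : (Fin 3 → ℤ) → EuclideanSpace ℂ (Fin 3)), IsDesignerForce N g → ∀ (E ε : ℝ), 0 < ε →
    ∃ η : ℝ, 0 < η ∧ ∀ ν : ℝ, 0 < ν → ∃ M : ℕ, ∀ (K : ℕ) (S : Finset (Fin 3 → ℤ)), S = (freqBall K).erase 0 →
      ∀ c : ℝ → ↥S → EuclideanSpace ℂ (Fin 3), IsCoeffTrajectory S ν g c →
        longTimeAvgSup (coeffEnergy c) ≤ E → ε ≤ longTimeAvgInf (coeffDissipation ν c) →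
          η ≤ longTimeAvgInf (coeffResolvedDissipation ν M c)

/-- **The fixed-viscosity instance of fraction's stub 2** (`η` may depend on `ν`; fraction §4, verbatim):
the de-risking target of line `fraction`, proved quantitatively (`η = 4π²νε²/Σ‖g_k‖²`, `M = N`) by the
forcing-band floor of `DecimationAxisGalerkinFloorForcingBandFloor.lean`. -/
def ResolvedFractionAtFixedViscosity : Prop :=
  ∀ ν : ℝ, 0 < ν → ∀ (N : ℕ) (g : (Fin 3 → ℤ) → EuclideanSpace ℂ (Fin 3)), IsDesignerForce N g → ∀ (E ε : ℝ), 0 < ε →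
    ∃ η : ℝ, 0 < η ∧ ∃ M : ℕ, ∀ (K : ℕ) (S : Finset (Fin 3 → ℤ)), S = (freqBall K).erase 0 →
      ∀ c : ℝ → ↥S → EuclideanSpace ℂ (Fin 3), IsCoeffTrajectory S ν g c →
        longTimeAvgSup (coeffEnergy c) ≤ E → ε ≤ longTimeAvgInf (coeffDissipation ν c) →
          η ≤ longTimeAvgInf (coeffResolvedDissipation ν M c)

/-! ## §2 Compositions (verbatim the skeletons' §3) and the by-statement comparisons (fraction §4) -/

/-- **Line `birth` closes the crux BY NAME modulo its two registered stubs**: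
`stub_uniformGalerkinAnomaly → stub_fixedViscosityResolution → DecimationAxis.GalerkinFloor`.
Keep the heart's `(N, g, E, ν)` and take `ε/3` as the crux's floor parameter; at level `j` the truncation
threshold `K₀` comes from stub 1 and the resolution wavenumber `M` from stub 2 at `(ν j, N, g, E, ε, δ := ε/3)`;
for `K ≥ K₀` the stub-1 trajectory meets stub 2's premises verbatim and `ε − ε/3 = 2·(ε/3)`. [bookkeeping] -/
theorem GalerkinFloor_of (hA : Statement.stub_uniformGalerkinAnomaly)
    (hB : Statement.stub_fixedViscosityResolution) : GalerkinFloor := by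
  obtain ⟨N, g, hg, E, ε, hε, ν, hν, hlim, hAj⟩ := hA
  obtain ⟨hs, hsupp, hg0, htr⟩ := hg
  refine ⟨N, g, hs, hsupp, hg0, htr, E, ε / 3, by positivity, ν, hν, hlim, fun j => ?_⟩
  obtain ⟨K₀, hK₀⟩ := hAj j
  obtain ⟨M, hM⟩ := hB (ν j) (hν j) N g ⟨hs, hsupp, hg0, htr⟩ E ε (ε / 3) (by positivity)
  refine ⟨M, K₀, fun K hK S hS => ?_⟩
  obtain ⟨c, hc, hE, hD⟩ := hK₀ K hK S hS
  obtain ⟨h1, h2, h3⟩ := hc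
  have hres : ε - ε / 3 ≤ longTimeAvgInf (coeffResolvedDissipation (ν j) M c) :=
    hM K S hS c ⟨h1, h2, h3⟩ hE hD
  have h23 : 2 * (ε / 3) = ε - ε / 3 := by ring
  refine ⟨c, h1, h2, h3, hE, ?_⟩
  rw [h23]
  exact hres

/-- **Line `fraction` closes the crux BY NAME modulo its two registered stubs**:
`stub_uniformGalerkinAnomaly → stub_uniformResolvedFraction → DecimationAxis.GalerkinFloor`.
Keep the heart's `(N, g, E, ν_j)`; take `η` from stub 2 at `(N, g, E, ε)` BEFORE choosing `j`; the crux's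
dissipation floor is `η/2`; at level `j`, `K₀` comes from the heart and `M` from stub 2 at `ν_j`. [bookkeeping] -/
theorem GalerkinFloor_of_uniformResolvedFraction (hA : Statement.stub_uniformGalerkinAnomaly)
    (hB : Statement.stub_uniformResolvedFraction) : GalerkinFloor := by
  obtain ⟨N, g, hg, E, ε, hε, ν, hν, hlim, hAj⟩ := hA
  obtain ⟨η, hη, hην⟩ := hB N g hg E ε hε
  obtain ⟨hs, hsupp, hg0, htr⟩ := hg
  refine ⟨N, g, hs, hsupp, hg0, htr, E, η / 2, by positivity, ν, hν, hlim, fun j => ?_⟩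
  obtain ⟨K₀, hK₀⟩ := hAj j
  obtain ⟨M, hM⟩ := hην (ν j) (hν j)
  refine ⟨M, K₀, fun K hK S hS => ?_⟩
  obtain ⟨c, hc, hE, hD⟩ := hK₀ K hK S hS
  obtain ⟨h1, h2, h3⟩ := hc
  have hres : η ≤ longTimeAvgInf (coeffResolvedDissipation (ν j) M c) :=
    hM K S hS c ⟨h1, h2, h3⟩ hE hD
  have h22 : 2 * (η / 2) = η := by ring
  refine ⟨c, h1, h2, h3, hE, ?_⟩
  rw [h22]
  exact hres

/-- **Birth's stub 2 implies fraction's stub 2** (`η := ε/2`, `δ := ε/2`): the line `fraction` is formally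
no harder than the line `birth`. [bookkeeping] -/
theorem uniformResolvedFraction_of_fixedViscosityResolution
    (h : Statement.stub_fixedViscosityResolution) : Statement.stub_uniformResolvedFraction := by
  intro N g hg E ε hε
  refine ⟨ε / 2, by positivity, fun ν hν => ?_⟩
  obtain ⟨M, hM⟩ := h ν hν N g hg E ε (ε / 2) (by positivity)
  refine ⟨M, fun K S hS c hc hE hD => ?_⟩
  have h1 : ε - ε / 2 = ε / 2 := by ring
  have := hM K S hS c hc hE hD
  rw [h1] at this
  exact this

/-- Uniform ⇒ pointwise: fraction's stub 2 implies its fixed-viscosity instance (the converse —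
uniformity of `η` as `ν → 0` — is the whole open content of that stub). [bookkeeping] -/
theorem resolvedFractionAtFixedViscosity_of_uniform (h : Statement.stub_uniformResolvedFraction) :
    ResolvedFractionAtFixedViscosity := by
  intro ν hν N g hg E ε hε
  obtain ⟨η, hη, hην⟩ := h N g hg E ε hε
  obtain ⟨M, hM⟩ := hην ν hν
  exact ⟨η, hη, M, hM⟩

end Summit.AnomalousDissipation.AnomalousDissipation.Cruxes.GalerkinFloor.Birth

end
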